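import Literature.Computability.Cryptography.CryptoFoundationsOneWayFunctionsProofs
import Literature.Computability.Complexity.KarpLipton
import HarnessLib

/-!
# Non-uniformly one-way functions imply `NP ⊄ P/poly`

`OneWayFunctionsPneNP.lean` records that each of the tree's one-way-function hypotheses implies
`NP ⊄ P` (Goldreich 2001, §2.7.4, Exercise 2). For the **non-uniform** hypothesis
`NonuniformOWFExist` (`OneWayFunctions.lean`: some polynomial-time `f` that no PPT adversary
*with polynomial advice* inverts with non-negligible probability, Goldreich's Def. 2.2.6 in the
advice rendering of §1.3.3) the natural consequence is the stronger, non-uniform separation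
`NP ⊄ P/poly`, and this file proves it inside the tree's models:

  `NP ⊆ P/poly` ⟹ no function is non-uniformly one-way
  (`not_isOneWayNonuniform_of_NP_subset_PPoly`), hence
  `NonuniformOWFExist → ¬ (NP ⊆ P/poly)` (`NP_not_subset_PPoly_of_NonuniformOWFExist`).

## The argument (folklore; Goldreich's guideline to §2.7.4 Ex. 2 run with advice circuits, i.e.
## the self-reducibility step of the Karp–Lipton theorem, Arora–Barak 2009, proof of Thm. 6.19)

Fix a polynomial-time `f`. Goldreich's `NP`-set of extendable partial preimages is, in the tree,
the prefix-search language `PrefixLang (invRel f) X` of the polynomial-time solution relation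
`invRel f = {⟨⟨u, y⟩, x'⟩ | |x'| = |u| ∧ f x' = y}` (`SearchToDecision.lean`, `invRel_mem_P`;
`KarpLipton.PrefixLang_mem_NP`). If `NP ⊆ P/poly`, polynomial-size `B₂`-circuits `Cₘ` decide it.
As advice for input length `n` take the list `W n` of the descriptions (`CircEval.desc`) of the
circuits `C₀, …, C_N` for all query lengths `≤ N(n) = 3(2n + 2 + p_f(n)) + 2`, where
`|f x| ≤ p_f(|x|)` bounds the output length of `f`; `|W n|` is polynomial in `n`
(`CircEval.length_desc_le`, `PRelSigPi.length_body_le`, exactly as in the completeness half of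
`KarpLipton.PiP_two_subset_SigmaP_two`). The adversary is the *deterministic* polynomial-time map

  `g ⟨W, x'⟩ = (KarpLipton.extractFn (invRel f) X ⟨⟨x', W⟩, ε⟩).2`,

Karp–Lipton's advice-driven self-reduction loop (`KarpLipton.extractFn_mem_FP`): starting from the
empty partial preimage it asks the advice circuit of the right length whether the current prefix
extended by `0` still extends to a preimage, and appends `0` or `1` accordingly; by
`KarpLipton.extractFn_spec`, with correct advice it ends in a genuine solution whenever one exists —
and on `x' = ⟨1ⁿ, f x⟩` with `|x| = n` the solution `x` exists. So
`f (g ⟨W n, ⟨1ⁿ, f x⟩⟩) = f x` for **every** `x` (`exists_advised_inverter_of_NP_subset_PPoly`):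
the advised inversion probability of the PPT algorithm `RandAlg.ofDet g` is identically `1`
(`invertProbAdv_ofDet_eq_one`), which is not negligible.

## Main statements

* `invertProbAdv_ofDet_eq_one` — a sure advised inverter has `invertProbAdv = 1`;
* `exists_advised_inverter_of_NP_subset_PPoly` — `NP ⊆ P/poly` ⇒ every `f ∈ FP` has a
  polynomial-time sure inverter with polynomial-length advice;
* `not_isOneWayNonuniform_of_NP_subset_PPoly` — `NP ⊆ P/poly` ⇒ no `f` is non-uniformly one-way;
* `NP_not_subset_PPoly_of_NonuniformOWFExist`, `not_NonuniformOWFExist_of_NP_subset_PPoly` —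
  `NonuniformOWFExist → NP ⊄ P/poly` and its contrapositive;
* `NP_not_subset_PPoly_of_NonuniformOWFHypothesis` — the same for the statement-level flag
  `NonuniformOWFHypothesis` (crypto-foundations.S22, definitionally `NonuniformOWFExist`).

Nothing is posited: all proofs assemble tree theorems (`KarpLipton.lean`, `SearchToDecision.lean`,
`CircuitEval.lean`, `RandomizedProofs.lean`).

## References

* O. Goldreich, *Foundations of Cryptography I: Basic Tools*, CUP 2001 (2004 printing,
  doi:10.1017/CBO9780511721656): Def. 2.2.6 and §2.2.5 (non-uniform one-wayness), §1.3.3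
  (non-uniform polynomial time as advice), §2.7.4 Exercise 2 and its guideline (the set `L_f`;
  one-way functions imply `P ≠ NP`).
* S. Arora, B. Barak, *Computational Complexity: A Modern Approach*, CUP 2009: Thm. 6.19
  (Karp–Lipton; proof: under `NP ⊆ P/poly` polynomial-size circuits output certificates by
  self-reducibility), Thm. 2.18 (search-to-decision), Thm. 6.18 (circuit evaluation in `P`),
  Def. 6.5 (`P/poly`).
* R. M. Karp, R. J. Lipton, *Some connections between nonuniform and uniform complexity classes*,
  STOC 1980, Thm. 6.1. doi:10.1145/800141.804678
-/

namespace Literature.Computability.Cryptography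

open Filter Asymptotics _root_.Computability Polynomial Complexity Complexity.Classes Complexity.Nondeterministic
open Literature.Computability.Complexity.KarpLipton Literature.Computability.Complexity.CircEval
open Literature.Computability.Complexity.OracleCompose

/-! ### A sure advised inverter has advised inversion probability `1` -/

/-- **A sure advised inverter has inversion probability `1`**: if `g`, given the advice `a n` and
`⟨1ⁿ, f x⟩`, returns a preimage of `f x` for every `x` of length `n`, then
`invertProbAdv f (RandAlg.ofDet g) a n = 1` (the coin-free algorithm's success event has
probability `1` on every `x`, `RandAlg.pr_ofDet`, and the uniform average of the constant `1` is
`1`). Advised twin of `invertProb_ofDet_eq_one`. [Goldreich 2001, Def. 2.2.6 with §1.3.3]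
[cite: Goldreich2001, Def. 2.2.6] -/
theorem invertProbAdv_ofDet_eq_one {f g : List Bool → List Bool} {a : ℕ → List Bool}
    (hg : ∀ (n : ℕ) (x : List Bool), x.length = n →
      f (g (boolPair (a n) (boolPair (unaryEncodeNat n) (f x)))) = f x)
    (n : ℕ) : invertProbAdv f (RandAlg.ofDet g) a n = 1 := by
  classical
  unfold invertProbAdv uniformAvg
  have h1 : ∀ x : List.Vector Bool n,
      (RandAlg.ofDet g).pr id (boolPair (a n) (boolPair (unaryEncodeNat n) (f x.toList)))
        {z | f z = f x.toList} = 1 := by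
    intro x
    rw [RandAlg.pr_ofDet, if_pos]
    exact hg n x.toList x.toList_length
  simp only [h1, Finset.sum_const, Finset.card_univ, card_vector, Fintype.card_bool, nsmul_eq_mul,
    mul_one]
  push_cast
  exact div_self (by positivity)

/-! ### `NP ⊆ P/poly` gives sure inverters with polynomial advice -/

/-- **`NP ⊆ P/poly` ⇒ every polynomial-time `f` has a polynomial-time sure inverter with
polynomial advice**: there are `g ∈ FP` and an advice sequence `a` of polynomial length such that
`g ⟨a n, ⟨1ⁿ, f x⟩⟩` is a preimage of `f x` of length `n`, for every `x` of length `n`.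
The advice `a n` is the list of descriptions of the polynomial-size circuits deciding the
prefix-search language `PrefixLang (invRel f) X ∈ NP ⊆ P/poly` at all query lengths
`≤ 3(2n + 2 + p_f(n)) + 2`; `g` swaps its input into the initial state `⟨⟨⟨1ⁿ, f x⟩, a n⟩, ε⟩` of
Karp–Lipton's advice-driven self-reduction loop `extractFn`, runs it, and reads off the
certificate (`extractFn_spec`). [Arora–Barak 2009, Thm. 6.19 (proof: circuits that output
certificates, via Thm. 2.18), applied to Goldreich 2001, §2.7.4 Ex. 2 (guideline: the set `L_f`)]
[cite: AroraBarakCC2009, Thm. 6.19] [folklore] -/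
theorem exists_advised_inverter_of_NP_subset_PPoly (hNP : NP ⊆ PPoly) {f : List Bool → List Bool}
    (hf : f ∈ FP) :
    ∃ g ∈ FP, ∃ a : ℕ → List Bool, IsPolyLength a ∧
      ∀ (n : ℕ) (x : List Bool), x.length = n →
        (g (boolPair (a n) (boolPair (unaryEncodeNat n) (f x)))).length = n ∧
          f (g (boolPair (a n) (boolPair (unaryEncodeNat n) (f x)))) = f x := by
  -- the solution relation and circuits for its prefix-search language
  have hR : invRel f ∈ Classes.P := invRel_mem_P hf
  have hA : PrefixLang (invRel f) X ∈ PPoly := hNP (PrefixLang_mem_NP (invRel f) X hR)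
  obtain ⟨s, C, hC, hdec⟩ : ∃ s : Polynomial ℕ, ∃ C : CircuitFamily,
      (∀ n, (C n).IsOver B2 ∧ (C n).size ≤ s.eval n) ∧ C.Decides (PrefixLang (invRel f) X) := by
    simpa [PPoly, SIZE] using hA
  have har : ∀ n, ∀ g ∈ (C n).gates, g.arity ≤ 2 := fun n g hg => (hC n).1 g hg
  -- output length bound of `f`
  obtain ⟨pf, hpf⟩ : ∃ pf : Polynomial ℕ, ∀ x, (f x).length ≤ pf.eval x.length := by
    obtain ⟨p, M, hM⟩ := hf
    exact ⟨X + Polynomial.C (TM2Comp.machinePushBound M.tm) * p, fun x => by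
      simpa using (hM x).length_le⟩
  -- polynomials: maximal query length, description length, advice length
  set Nm : Polynomial ℕ := 3 * (2 * X + 2 + pf) + 2 with hNm
  set Dm : Polynomial ℕ := (s.comp Nm + 1) * (8 * (Nm + s.comp Nm) + 10) with hDm
  set P₁ : Polynomial ℕ := (Nm + 1) * (2 * Dm + 2) with hP₁
  have hNval : ∀ n, Nm.eval n = 3 * (2 * n + 2 + pf.eval n) + 2 := fun n => by simp [hNm]
  -- the advice: the descriptions of the circuits at all query lengths `≤ Nm n`
  obtain ⟨a, ha⟩ : ∃ a : ℕ → List Bool,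
      ∀ n, a n = body (List.ofFn fun i : Fin (Nm.eval n + 1) => desc (C i)) :=
    ⟨fun n => body (List.ofFn fun i : Fin (Nm.eval n + 1) => desc (C i)), fun _ => rfl⟩
  -- the adversary: swap into the initial state, run the extraction, read off the certificate
  obtain ⟨g, hgdef⟩ : ∃ g : List Bool → List Bool,
      g = sndP ∘ extractFn (invRel f) X ∘ pairFn (pairFn sndP fstP) (fun _ => []) := ⟨_, rfl⟩
  have hg : g ∈ FP := by
    rw [hgdef]
    exact comp_mem_FP sndP_mem_FP (comp_mem_FP (extractFn_mem_FP (invRel f) X hR)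
      (pairFn_mem_FP (pairFn_mem_FP sndP_mem_FP fstP_mem_FP) (const_mem_FP [])))
  have hgval : ∀ W x' : List Bool,
      g (boolPair W x') = sndP (extractFn (invRel f) X (boolPair (boolPair x' W) [])) := by
    intro W x'
    rw [hgdef]
    simp only [Function.comp_apply, pairFn_apply, sndP_boolPair, fstP_boolPair]
  -- the advice answers all short queries correctly
  have hAns : ∀ (n : ℕ) (Q : List Bool), Q.length ≤ Nm.eval n →
      (Answer (a n) Q ↔ Q ∈ PrefixLang (invRel f) X) := by
    intro n Q hQ
    have hel : PRelSigPi.elemFn (boolPair Q (a n)) = desc (C Q.length) := by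
      rw [ha n, PRelSigPi.elemFn_boolPair_body, getD_ofFn _ _ (Nat.lt_succ_of_le hQ)]
    rw [Answer, hel, evalFn_boolPair_desc Q (C Q.length) (har Q.length), hdec Q, List.cons.injEq]
    simp only [and_true]
    exact (Set.mem_iff_boolIndicator _ _).symm
  -- the advice is short
  have halen : ∀ n, (a n).length ≤ P₁.eval n := by
    intro n
    set N := Nm.eval n with hN
    have hdesc : ∀ c ∈ (List.ofFn fun i : Fin (N + 1) => desc (C i)), c.length ≤ Dm.eval n := by
      intro c hc
      rw [List.mem_ofFn] at hc
      obtain ⟨i, rfl⟩ := hc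
      have hi : (i : ℕ) ≤ N := Nat.lt_succ_iff.1 i.isLt
      have h1 := length_desc_le (C i)
      have h2 : (C i).size ≤ s.eval (i : ℕ) := (hC i).2
      have h3 : s.eval (i : ℕ) ≤ s.eval N := TM2Iter.eval_mono s hi
      have hD : Dm.eval n = (s.eval N + 1) * (8 * (N + s.eval N) + 10) := by
        simp [hDm, hN, eval_comp]
      rw [hD]
      exact h1.trans (Nat.mul_le_mul (by omega) (by omega))
    have hbody := PRelSigPi.length_body_le hdesc
    have hlen : (List.ofFn fun i : Fin (N + 1) => desc (C i)).length = N + 1 := List.length_ofFn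
    rw [hlen] at hbody
    have hP : P₁.eval n = (N + 1) * (2 * Dm.eval n + 2) := by simp [hP₁, hN]
    rw [ha n, hP]
    exact hbody
  refine ⟨g, hg, a, ⟨P₁, halen⟩, fun n x hx => ?_⟩
  -- the run on `⟨a n, ⟨1ⁿ, f x⟩⟩`
  have hn : (unaryEncodeNat n).length = n := unary_decode_encode_nat n
  have hfx : (f x).length ≤ pf.eval n := hx ▸ hpf x
  have h0 : boolPair (boolPair (unaryEncodeNat n) (f x)) [] ∈ PrefixLang (invRel f) X := by
    refine (boolPair_mem_PrefixLang (invRel f) X _ []).2 ⟨x, ?_, ?_⟩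
    · rw [List.nil_append, eval_X, length_boolPair, hn, hx]
      omega
    · rw [List.nil_append]
      exact (boolPair_mem_invRel f _ _ x).2 ⟨hx.trans hn.symm, rfl⟩
  have hWq : ∀ v : List Bool,
      v.length ≤ (X : Polynomial ℕ).eval (boolPair (unaryEncodeNat n) (f x)).length →
      (Answer (a n) (boolPair (boolPair (unaryEncodeNat n) (f x)) v) ↔
        boolPair (boolPair (unaryEncodeNat n) (f x)) v ∈ PrefixLang (invRel f) X) := by
    intro v hv
    apply hAns
    rw [eval_X, length_boolPair, hn] at hv
    rw [hNval, length_boolPair, length_boolPair, hn]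
    omega
  obtain ⟨v, hext, -, hvR⟩ := extractFn_spec (invRel f) X _ (a n) hWq h0
  obtain ⟨hlen, hfv⟩ := (boolPair_mem_invRel f _ _ v).1 hvR
  rw [hgval, hext, sndP_boolPair]
  exact ⟨hlen.trans hn, hfv⟩

/-! ### No non-uniformly one-way functions if `NP ⊆ P/poly` -/

/-- **No function is non-uniformly one-way if `NP ⊆ P/poly`.** The sure advised inverter `g` with
advice `a` of `exists_advised_inverter_of_NP_subset_PPoly` is a PPT algorithm
(`RandAlg.IsPolyTime.ofDet_holds`) with polynomial-length advice whose advised inversion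
probability is identically `1` (`invertProbAdv_ofDet_eq_one`), and the constant `1` is not
negligible. Non-uniform form of Goldreich 2001, §2.7.4, Exercise 2. [Goldreich 2001, Def. 2.2.6,
§2.7.4 Ex. 2; Arora–Barak 2009, Thm. 6.19 (proof)] [cite: Goldreich2001, §2.7.4 Exercise 2]
[folklore] -/
theorem not_isOneWayNonuniform_of_NP_subset_PPoly (hNP : NP ⊆ PPoly) (f : List Bool → List Bool) :
    ¬ IsOneWayNonuniform f := by
  rintro ⟨hf, hsec⟩
  obtain ⟨g, hg, a, ha, hinv⟩ := exists_advised_inverter_of_NP_subset_PPoly hNP hf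
  have hdecay := hsec (RandAlg.ofDet g) (RandAlg.IsPolyTime.ofDet_holds hg) a ha
  have h1 : invertProbAdv f (RandAlg.ofDet g) a = fun _ => (1 : ℝ) :=
    funext (invertProbAdv_ofDet_eq_one fun n x hx => (hinv n x hx).2)
  rw [h1] at hdecay
  have h0 := hdecay 0
  simp only [pow_zero, one_mul] at h0
  exact one_ne_zero (tendsto_nhds_unique tendsto_const_nhds h0)

/-- **Non-uniformly one-way functions imply `NP ⊄ P/poly`** — the non-uniform strengthening of
`NP_not_subset_P_of_NonuniformOWFExist` (`OneWayFunctionsPneNP.lean`). [Goldreich 2001, Def. 2.2.6,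
§2.7.4 Ex. 2; Arora–Barak 2009, Thm. 6.19 (proof)] [cite: Goldreich2001, §2.7.4 Exercise 2]
[folklore] -/
theorem NP_not_subset_PPoly_of_NonuniformOWFExist (h : NonuniformOWFExist) : ¬ (NP ⊆ PPoly) :=
  fun hNP => h.elim fun f hf => not_isOneWayNonuniform_of_NP_subset_PPoly hNP f hf

/-- **Contrapositive**: if `NP ⊆ P/poly` then there are no non-uniformly one-way functions (every
polynomial-time `f` is surely inverted by a polynomial-time adversary with polynomial advice).
[Goldreich 2001, Def. 2.2.6, §2.7.4 Ex. 2] [cite: Goldreich2001, §2.7.4 Exercise 2] [folklore] -/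
theorem not_NonuniformOWFExist_of_NP_subset_PPoly (hNP : NP ⊆ PPoly) : ¬ NonuniformOWFExist :=
  fun h => NP_not_subset_PPoly_of_NonuniformOWFExist h hNP

/-- **The S22 flag `NonuniformOWFHypothesis` implies `NP ⊄ P/poly`** (the flag is definitionally
`NonuniformOWFExist`, `CryptoFoundationsOneWayFunctions.lean`). [Goldreich 2001, Def. 2.2.6,
§2.7.4 Ex. 2] [cite: Goldreich2001, §2.7.4 Exercise 2] [folklore] -/
theorem NP_not_subset_PPoly_of_NonuniformOWFHypothesis (h : NonuniformOWFHypothesis) : ¬ (NP ⊆ PPoly) :=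
  NP_not_subset_PPoly_of_NonuniformOWFExist h

end Literature.Computability.Cryptography
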